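import Literature.AlgebraicGeometry.Smoothening.SmootheningCombinators
import Mathlib.RingTheory.Smooth.Basic
import HarnessLib

/-!
# The generic fibre of a chart of the affine forest is a principal open of `X_K` (BLR 3.4)

Topic: `Literature/AlgebraicGeometry/Smoothening` (Bosch–Lütkebohmert–Raynaud, *Néron Models*,
§3.2 Prop. 1 (dilatations do not change the generic fibre) and §3.4 Thm. 2 (the smoothening
`X' → X` is an isomorphism on generic fibres above the smooth locus; in the affine-forest form
each chart is an open part)). For a path `p` of the affine forest (`ForestPath`) from
`X = Spec A`, `A = R[T]/I`, to `X' = Spec A'`, with structure map `p.map : A → A'`, the ring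
`A'[1/ϖ]` is the localisation of `A[1/ϖ]` away from one element: **`A'[1/ϖ] = A[1/(ϖ f)]` for
some `f ∈ A`** (`ForestPath.exists_isLocalization_away`), i.e. `X'_K → X_K` is the open immersion
of a principal open. The statement is given for an arbitrary realisation `T` of `A'[1/ϖ]`
(any `A'`-algebra which is a localisation away from `ϖ`) with any compatible `A`-algebra
structure. Steps: an open chart `A' → A'_h̄` contributes `h̄`, made into an element of `A` up to
a unit of `A[1/(ϖ f)]` (`exists_away_of_away_chart`); a dilatation contributes nothing
(`isLocalization_away_of_dilChart`, from `Dilatations.dilatation.isLocalization_away`).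
[folklore]; no named facts (D-0026).

## References

* S. Bosch, W. Lütkebohmert, M. Raynaud, *Néron Models*, Springer 1990, §3.2 Prop. 1, §3.4
  Thm. 2. [BLRNeronModels1990] (Not held; numbers only.)
* A. Mayeux, T. Richarz, M. Romagny, *Néron blowups and low-degree cohomological
  applications*, arXiv:2001.03597, §2.1 (`B[I/b][b⁻¹] = B[b⁻¹]`). [MayeuxRicharzRomagny2020]
-/

noncomputable section

open MvPolynomial
open Literature.AlgebraicGeometry.Dilatations Literature.AlgebraicGeometry.Resolution

namespace Literature.AlgebraicGeometry.Smoothening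

universe u

/-! ### Localisations: change of algebra structure, one abstract step -/

section Abstract

/-- `IsLocalization` only depends on the structure map: transfer along an equality of
`algebraMap`s. [folklore] -/
theorem IsLocalization.of_algebraMap_eq' {A T : Type u} [CommRing A] [CommRing T] (M : Submonoid A)
    (i₁ i₂ : Algebra A T) (h : ∀ a, i₁.algebraMap a = i₂.algebraMap a)
    (H : @IsLocalization A _ M T _ i₁) : @IsLocalization A _ M T _ i₂ := by
  have heq : i₁.algebraMap = i₂.algebraMap := RingHom.ext h
  rw [@isLocalization_iff_isLocalizationMap] at H ⊢
  change M.IsLocalizationMap i₂.algebraMap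
  rw [← heq]
  exact H

/-- **Cancellation of localisations**: if `S = R[1/x]` and `T = R[1/(x y)]` as an `S`-algebra,
then `T = S[1/y]`. [folklore] -/
theorem IsLocalization.Away.of_away_mul {R₀ S T : Type u} [CommRing R₀] [CommRing S] [CommRing T]
    [Algebra R₀ S] [Algebra S T] [Algebra R₀ T] [IsScalarTower R₀ S T] (x y : R₀)
    [IsLocalization.Away x S] [IsLocalization.Away (x * y) T] :
    IsLocalization.Away (algebraMap R₀ S y) T := by
  have hxT : IsUnit (algebraMap R₀ T x) :=
    IsLocalization.Away.isUnit_of_dvd (x := x * y) (S := T) (dvd_mul_right x y)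
  have hyT : IsUnit (algebraMap R₀ T y) :=
    IsLocalization.Away.isUnit_of_dvd (x := x * y) (S := T) (dvd_mul_left y x)
  refine IsLocalization.Away.mk _ ?_ (fun t => ?_) (fun s₁ s₂ h => ?_)
  · rwa [← IsScalarTower.algebraMap_apply]
  · obtain ⟨n, a, ha⟩ := IsLocalization.Away.surj (x * y) (S := T) t
    refine ⟨n, algebraMap R₀ S a * IsLocalization.Away.invSelf x ^ n, ?_⟩
    have hinv : algebraMap R₀ T x * algebraMap S T (IsLocalization.Away.invSelf x) = 1 := by
      rw [IsScalarTower.algebraMap_apply R₀ S T x, ← map_mul, IsLocalization.Away.mul_invSelf, map_one]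
    calc t * algebraMap S T (algebraMap R₀ S y) ^ n
        = t * algebraMap R₀ T y ^ n * (algebraMap R₀ T x * algebraMap S T (IsLocalization.Away.invSelf x)) ^ n := by
          rw [← IsScalarTower.algebraMap_apply, hinv, one_pow, mul_one]
      _ = t * algebraMap R₀ T (x * y) ^ n * algebraMap S T (IsLocalization.Away.invSelf x) ^ n := by
          rw [map_mul, mul_pow, mul_pow]; ring
      _ = algebraMap S T (algebraMap R₀ S a * IsLocalization.Away.invSelf x ^ n) := by
          rw [ha, map_mul, map_pow, ← IsScalarTower.algebraMap_apply]
  · obtain ⟨m₁, a₁, h₁⟩ := IsLocalization.Away.surj x s₁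
    obtain ⟨m₂, a₂, h₂⟩ := IsLocalization.Away.surj x s₂
    have hT : algebraMap R₀ T (a₁ * x ^ m₂) = algebraMap R₀ T (a₂ * x ^ m₁) := by
      rw [map_mul, map_mul, IsScalarTower.algebraMap_apply R₀ S T a₁,
        IsScalarTower.algebraMap_apply R₀ S T a₂, ← h₁, ← h₂, map_mul, map_mul, h, map_pow, map_pow,
        map_pow, map_pow, ← IsScalarTower.algebraMap_apply]
      ring
    obtain ⟨k, hk⟩ := IsLocalization.Away.exists_of_eq (S := T) (x * y) hT
    refine ⟨k, ?_⟩
    have hu : IsUnit (algebraMap R₀ S x ^ (k + m₁ + m₂)) :=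
      (IsLocalization.Away.algebraMap_isUnit x).pow _
    refine (hu.mul_left_inj).mp ?_
    have hk' := congrArg (algebraMap R₀ S) hk
    simp only [map_mul, map_pow] at hk'
    calc algebraMap R₀ S y ^ k * s₁ * algebraMap R₀ S x ^ (k + m₁ + m₂)
        = (algebraMap R₀ S x * algebraMap R₀ S y) ^ k *
            ((s₁ * algebraMap R₀ S x ^ m₁) * algebraMap R₀ S x ^ m₂) := by ring
      _ = (algebraMap R₀ S x * algebraMap R₀ S y) ^ k *
            ((s₂ * algebraMap R₀ S x ^ m₂) * algebraMap R₀ S x ^ m₁) := by rw [h₁, h₂]; exact hk'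
      _ = algebraMap R₀ S y ^ k * s₂ * algebraMap R₀ S x ^ (k + m₁ + m₂) := by ring

variable {A A' A₁ : Type u} [CommRing A] [CommRing A'] [CommRing A₁] (φ : A →+* A')
  [Algebra A' A₁] (ϖA : A) (ϖ' : A') (h : A') [IsLocalization.Away h A₁]
  (T' : Type u) [CommRing T'] [Algebra A' T'] [IsLocalization.Away ϖ' T']
  (T₁ : Type u) [CommRing T₁] [Algebra A₁ T₁] [IsLocalization.Away (algebraMap A' A₁ ϖ') T₁]

include ϖ' h in
/-- **One open chart.** Let `φ : A → A'`, `T' = A'[1/ϖ']` with `T' = A[1/(ϖ f)]` through `φ`,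
`A₁ = A'_h` and `T₁ = A₁[1/ϖ']`. Then `T₁ = A[1/(ϖ g)]` through `A → A' → A₁ → T₁` for some
`g ∈ A` (`h/1 ∈ T'` is a unit multiple of some `y/1`, `y ∈ A`; take `g = f y`). [folklore] -/
theorem exists_away_of_away_chart (f : A)
    (hT' : @IsLocalization.Away A _ (ϖA * f) T' _ ((algebraMap A' T').comp φ).toAlgebra)
    (iA : Algebra A T₁) (hT₁ : ∀ a, iA.algebraMap a = algebraMap A₁ T₁ (algebraMap A' A₁ (φ a))) :
    ∃ g : A, @IsLocalization.Away A _ (ϖA * g) T₁ _ iA := by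
  -- `A' → A₁ → T₁`
  letI algA'T₁ : Algebra A' T₁ := ((algebraMap A₁ T₁).comp (algebraMap A' A₁)).toAlgebra
  haveI : IsScalarTower A' A₁ T₁ := IsScalarTower.of_algebraMap_eq (R := A') (S := A₁) (A := T₁)
    fun _ => rfl
  -- `T₁ = A'[1/(ϖ' h)]`
  haveI h1 : IsLocalization.Away (ϖ' * h) T₁ := IsLocalization.Away.mul A₁ T₁ h ϖ'
  -- `T' → T₁`
  have hunit : IsUnit (algebraMap A' T₁ ϖ') :=
    IsLocalization.Away.isUnit_of_dvd (x := ϖ' * h) (S := T₁) (dvd_mul_right ϖ' h)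
  letI algT'T₁ : Algebra T' T₁ := (IsLocalization.Away.lift ϖ' (g := algebraMap A' T₁) hunit).toAlgebra
  haveI : IsScalarTower A' T' T₁ := IsScalarTower.of_algebraMap_eq (R := A') (S := T') (A := T₁)
    fun a => (IsLocalization.Away.lift_eq ϖ' (g := algebraMap A' T₁) hunit a).symm
  -- `T₁ = T'[1/h]`
  haveI h2 : IsLocalization.Away (algebraMap A' T' h) T₁ :=
    IsLocalization.Away.commutes (R := A') T' A₁ T₁ ϖ' h
  -- `h/1` is a unit multiple of some `y/1`, `y ∈ A`
  letI algAT' : Algebra A T' := ((algebraMap A' T').comp φ).toAlgebra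
  haveI := hT'
  obtain ⟨n, y, hy⟩ := IsLocalization.Away.surj (ϖA * f) (S := T') (algebraMap A' T' h)
  have hassoc : Associated (algebraMap A T' y) (algebraMap A' T' h) := by
    refine ⟨((IsLocalization.Away.algebraMap_isUnit (S := T') (ϖA * f)).pow n).unit⁻¹, ?_⟩
    rw [← hy, mul_assoc, IsUnit.mul_val_inv, mul_one]
  haveI h3 : IsLocalization.Away (algebraMap A T' y) T₁ := IsLocalization.Away.of_associated hassoc.symm
  -- `T₁ = A[1/(ϖ f y)]`
  letI := iA
  haveI : IsScalarTower A T' T₁ := IsScalarTower.of_algebraMap_eq (R := A) (S := T') (A := T₁)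
    fun a => by
      rw [hT₁]
      change _ = IsLocalization.Away.lift ϖ' (g := algebraMap A' T₁) hunit (algebraMap A' T' (φ a))
      rw [IsLocalization.Away.lift_eq]
      rfl
  refine ⟨f * y, ?_⟩
  have h4 : IsLocalization.Away (y * (ϖA * f)) T₁ := IsLocalization.Away.mul T' T₁ (ϖA * f) y
  rw [show ϖA * (f * y) = y * (ϖA * f) by ring]
  exact h4

end Abstract

/-! ### The dilatation step does not change `A[1/ϖ]` -/

section Dil

variable {R : Type u} [CommRing R] (ϖ : R) {N r : ℕ} (I : Ideal (MvPolynomial (Fin N) R))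
  (g : Fin r → MvPolynomial (Fin N) R) (h : MvPolynomial (Fin N) R)

local notation "A₁" => MvPolynomial (Fin (N + 1)) R ⧸ chartIdeal I h
local notation "D₁" => dilatation ϖ (centreIdeal ϖ (chartIdeal I h) (chartGens g h))
local notation "A₂" => MvPolynomial (Fin (N + 1 + (r + 1))) R ⧸
  dilIdeal ϖ (chartIdeal I h) (chartGens g h)

set_option maxHeartbeats 400000 in
/-- **A dilatation does not change the generic fibre**: any realisation `T₂` of `A₂[1/ϖ]`,
`A₂ = R[T, U, Z]/I''` the dilatation chart of `A₁ = R[T, U]/I'`, is the localisation of `A₁` away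
from `ϖ` (through `A₁ → A₂ → T₂`). [folklore] -/
theorem isLocalization_away_of_dilChart (T₂ : Type u) [CommRing T₂] [Algebra A₂ T₂]
    [IsLocalization.Away (algebraMap R A₂ ϖ) T₂] :
    @IsLocalization.Away A₁ _ (algebraMap R A₁ ϖ) T₂ _
      ((algebraMap A₂ T₂).comp (algebraMap A₁ A₂)).toAlgebra := by
  letI algA₁T₂ : Algebra A₁ T₂ := ((algebraMap A₂ T₂).comp (algebraMap A₁ A₂)).toAlgebra
  haveI : IsScalarTower A₁ A₂ T₂ := IsScalarTower.of_algebraMap_eq (R := A₁) (S := A₂) (A := T₂)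
    fun _ => rfl
  -- `T₂` as a `D₁`-algebra through `e : D₁ ≃ A₂`
  let e : D₁ ≃ₐ[A₁] A₂ := dilEquiv' ϖ (chartIdeal I h) (chartGens g h)
  letI algDT₂ : Algebra D₁ T₂ := ((algebraMap A₂ T₂).comp (e : D₁ →+* A₂)).toAlgebra
  haveI : IsScalarTower A₁ D₁ T₂ := IsScalarTower.of_algebraMap_eq (R := A₁) (S := D₁) (A := T₂)
    fun a => by
      change algebraMap A₂ T₂ (algebraMap A₁ A₂ a) = algebraMap A₂ T₂ (e (algebraMap A₁ D₁ a))
      rw [AlgEquiv.commutes]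
  -- `T₂ = D₁[1/ϖ]`: transport of `T₂ = A₂[1/ϖ]` along `e`
  haveI hD : IsLocalization.Away (algebraMap R D₁ ϖ) T₂ := by
    have key := IsLocalization.isLocalization_of_base_ringEquiv
      (Submonoid.powers (algebraMap R A₂ ϖ)) T₂ (e.symm : A₂ ≃+* D₁)
    rw [Submonoid.map_powers] at key
    have hϖ : (e.symm : A₂ ≃+* D₁) (algebraMap R A₂ ϖ) = algebraMap R D₁ ϖ := by
      change e.symm (algebraMap R A₂ ϖ) = algebraMap R D₁ ϖ
      rw [IsScalarTower.algebraMap_apply R A₁ A₂, IsScalarTower.algebraMap_apply R A₁ D₁]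
      exact e.symm.commutes _
    rw [hϖ] at key
    refine IsLocalization.of_algebraMap_eq' _ _ _ (fun d => ?_) key
    change algebraMap A₂ T₂ ((e.symm : A₂ ≃+* D₁).symm d) = algebraMap A₂ T₂ (e d)
    rfl
  -- `T₁' = A₁[1/ϖ]` is also `D₁[1/ϖ]`; compare
  haveI : IsLocalization.Away (algebraMap R D₁ ϖ) (Localization.Away (algebraMap R A₁ ϖ)) :=
    dilatation.isLocalization_away ϖ _
  let e' : Localization.Away (algebraMap R A₁ ϖ) ≃ₐ[D₁] T₂ :=
    IsLocalization.algEquiv (Submonoid.powers (algebraMap R D₁ ϖ)) _ _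
  let e'' : Localization.Away (algebraMap R A₁ ϖ) ≃ₐ[A₁] T₂ := e'.restrictScalars A₁
  exact IsLocalization.isLocalization_of_algEquiv (Submonoid.powers (algebraMap R A₁ ϖ)) e''

end Dil

/-! ### Paths -/

section Path

variable {R : Type u} [CommRing R] {ϖ : R} {N : ℕ} {I : Ideal (MvPolynomial (Fin N) R)}

local notation "A₀" => MvPolynomial (Fin N) R ⧸ I

set_option maxHeartbeats 400000 in
/-- **The generic fibre of a chart of the affine forest is a principal open of `X_K`**: for a
path `p` from `A = R[T]/I` to `A' = R[T']/I'` and any realisation `T` of `A'[1/ϖ]` with a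
compatible `A`-algebra structure, `T = A[1/(ϖ f)]` for some `f ∈ A`. [folklore] -/
theorem ForestPath.exists_isLocalization_away :
    ∀ {N' : ℕ} {I' : Ideal (MvPolynomial (Fin N') R)} (p : ForestPath R ϖ I I')
      (T : Type u) [CommRing T] [Algebra (MvPolynomial (Fin N') R ⧸ I') T]
      [IsLocalization.Away (algebraMap R (MvPolynomial (Fin N') R ⧸ I') ϖ) T]
      (iA : Algebra A₀ T),
      (∀ a, iA.algebraMap a = algebraMap (MvPolynomial (Fin N') R ⧸ I') T (p.map a)) →
        ∃ f : A₀, @IsLocalization.Away A₀ _ (algebraMap R A₀ ϖ * f) T _ iA := by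
  intro N' I' p
  induction p with
  | refl =>
    intro T _ _ _ iA hT
    refine ⟨1, ?_⟩
    rw [mul_one]
    exact IsLocalization.of_algebraMap_eq' _ _ _ (fun a => (hT a).symm) inferInstance
  | @openChart N' I' p f ih =>
    intro T _ _ _ iA hT
    haveI : IsLocalization.Away (algebraMap (MvPolynomial (Fin N') R ⧸ I')
        (MvPolynomial (Fin (N' + 1)) R ⧸ chartIdeal I' f) (algebraMap R _ ϖ)) T := by
      rw [← IsScalarTower.algebraMap_apply]; infer_instance
    obtain ⟨f₀, hf₀⟩ := ih (Localization.Away (algebraMap R (MvPolynomial (Fin N') R ⧸ I') ϖ))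
      (((algebraMap _ _).comp p.map.toRingHom).toAlgebra) fun _ => rfl
    exact exists_away_of_away_chart p.map.toRingHom (algebraMap R A₀ ϖ) (algebraMap R _ ϖ)
      (Ideal.Quotient.mk I' f) _ T f₀ hf₀ iA hT
  | @dilChart N' r I' p g h ih =>
    intro T _ _ _ iA hT
    letI algA₁T : Algebra (MvPolynomial (Fin (N' + 1)) R ⧸ chartIdeal I' h) T :=
      ((algebraMap _ T).comp (algebraMap (MvPolynomial (Fin (N' + 1)) R ⧸ chartIdeal I' h)
        (MvPolynomial (Fin (N' + 1 + (r + 1))) R ⧸ dilIdeal ϖ (chartIdeal I' h) (chartGens g h)))).toAlgebra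
    haveI hA₁ := isLocalization_away_of_dilChart ϖ I' g h T
    haveI : IsLocalization.Away (algebraMap (MvPolynomial (Fin N') R ⧸ I')
        (MvPolynomial (Fin (N' + 1)) R ⧸ chartIdeal I' h) (algebraMap R _ ϖ)) T := by
      rw [← IsScalarTower.algebraMap_apply]; exact hA₁
    obtain ⟨f₀, hf₀⟩ := ih (Localization.Away (algebraMap R (MvPolynomial (Fin N') R ⧸ I') ϖ))
      (((algebraMap _ _).comp p.map.toRingHom).toAlgebra) fun _ => rfl
    exact exists_away_of_away_chart (A₁ := MvPolynomial (Fin (N' + 1)) R ⧸ chartIdeal I' h)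
      p.map.toRingHom (algebraMap R A₀ ϖ) (algebraMap R _ ϖ) (Ideal.Quotient.mk I' h) _ T f₀ hf₀ iA
      fun a => by rw [hT]; rfl

set_option maxHeartbeats 400000 in
/-- **Smoothness of the generic fibre is inherited by the charts of the affine forest**: if some
(any) realisation `A₀'` of `A[1/ϖ]` is formally smooth over `R`, then so is every realisation `T`
of `A'[1/ϖ]` for a path from `A` to `A'` (`T = A₀'[1/f]` is a localisation of `A₀'`,
`IsLocalization.Away.of_away_mul`). [folklore] -/
theorem ForestPath.formallySmooth_of_formallySmooth {N' : ℕ} {I' : Ideal (MvPolynomial (Fin N') R)}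
    (p : ForestPath R ϖ I I') (A₀' : Type u) [CommRing A₀'] [Algebra A₀ A₀'] [Algebra R A₀']
    [IsScalarTower R A₀ A₀'] [IsLocalization.Away (algebraMap R A₀ ϖ) A₀'] [Algebra.FormallySmooth R A₀']
    (T : Type u) [CommRing T] [Algebra (MvPolynomial (Fin N') R ⧸ I') T] [Algebra R T]
    [IsScalarTower R (MvPolynomial (Fin N') R ⧸ I') T]
    [IsLocalization.Away (algebraMap R (MvPolynomial (Fin N') R ⧸ I') ϖ) T] :
    Algebra.FormallySmooth R T := by
  letI iA : Algebra A₀ T := ((algebraMap (MvPolynomial (Fin N') R ⧸ I') T).comp p.map.toRingHom).toAlgebra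
  obtain ⟨f, hf⟩ := p.exists_isLocalization_away T iA fun _ => rfl
  haveI := hf
  -- `A₀' → T`
  have hunit : IsUnit (algebraMap A₀ T (algebraMap R A₀ ϖ)) :=
    IsLocalization.Away.isUnit_of_dvd (x := algebraMap R A₀ ϖ * f) (S := T) (dvd_mul_right _ f)
  letI : Algebra A₀' T :=
    (IsLocalization.Away.lift (algebraMap R A₀ ϖ) (g := algebraMap A₀ T) hunit).toAlgebra
  haveI : IsScalarTower A₀ A₀' T := IsScalarTower.of_algebraMap_eq (R := A₀) (S := A₀') (A := T)
    fun a => (IsLocalization.Away.lift_eq (algebraMap R A₀ ϖ) (g := algebraMap A₀ T) hunit a).symm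
  haveI : IsScalarTower R A₀' T := IsScalarTower.of_algebraMap_eq (R := R) (S := A₀') (A := T)
    fun r => by
      rw [IsScalarTower.algebraMap_apply R A₀ A₀', ← IsScalarTower.algebraMap_apply A₀ A₀' T]
      change _ = algebraMap (MvPolynomial (Fin N') R ⧸ I') T (p.map (algebraMap R A₀ r))
      rw [AlgHom.commutes, ← IsScalarTower.algebraMap_apply]
  -- `T = A₀'[1/f]`
  haveI : IsLocalization.Away (algebraMap A₀ A₀' f) T :=
    IsLocalization.Away.of_away_mul (algebraMap R A₀ ϖ) f
  haveI : Algebra.FormallySmooth A₀' T :=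
    Algebra.FormallySmooth.of_isLocalization (Rₘ := T) (Submonoid.powers (algebraMap A₀ A₀' f))
  exact Algebra.FormallySmooth.comp R A₀' T

end Path

end Literature.AlgebraicGeometry.Smoothening

end
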